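import Summits.ResolutionOfSingularities.ResolutionOfSingularities.Theorems.WildConesClassicalRegimesDefs

/-!
# Route `WildCones`, crux `ClassicalRegimes` (stmt-ResolutionOfSingularities-16884), line `milnor-descent`:
# stub `stub_ordPExitSurface` — cleaned order exactly `p` exits multiplicity `p` (surfaces, `n = 2`)

For the point-blow-up dynamics of `z^p = a(u₁,u₂)` named in
`Theorems/WildConesClassicalRegimesDefs.lean` (`clean`, `bl`, `ord`, `dv`, `tr`, `step`, `MultP`,
`OrdP`), we prove: if a state `c` has multiplicity `p` (`MultP p 2 κ c`: the cleaned coefficient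
function `a = clean p 2 κ c` is non-zero and supported in total degree `≥ p`) and a monomial of
degree exactly `p` (`OrdP p 2 κ c`), then for every chart `i : Fin 2` and every translation `τ` the
successor `step p 2 κ i τ c` does NOT have multiplicity `p`.

Argument (chart `i`, other index `j`). Since `a` is cleaned, its degree-`p` coefficients at the pure
powers `u_i^p`, `u_j^p` vanish; let `d` be the largest `k ≤ p` with `a (i ↦ p - k, j ↦ k) ≠ 0`
(it exists by `OrdP`), so `0 < d < p`. Under `MultP` the division exponent of `step` is `p`, and
`dv i p (bl i a)` has coefficient `a (i ↦ B i + p - B j, j ↦ B j)` at `B` (if `B j ≤ B i + p`).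
Translating by `τ` and evaluating at `B⋆ = (i ↦ 0, j ↦ d)`, every summand with `D j > 0` reads a
degree-`p` coefficient of `a` with `j`-exponent `> d`, hence vanishes by maximality of `d`; the
summand `D = 0` gives `a (i ↦ p - d, j ↦ d) ≠ 0`. As `p ∤ d`, cleaning keeps this coefficient, of
total degree `d < p` — contradicting `MultP` of the successor. Pure finite-sum bookkeeping; the
hypotheses `CharP`, `PerfectField` are not used. [folklore]
-/

noncomputable section

-- single-problem summit: the doubled namespace component `ResolutionOfSingularities` is forced
set_option linter.dupNamespace false

open scoped BigOperators Classical

namespace Summit.ResolutionOfSingularities.ResolutionOfSingularities.Theorems.WildCones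

namespace OrdPExitSurface

/-! ## Generic facts on the calculus -/

/-- Under `MultP c` the cleaned order is at least `p`. [folklore] -/
theorem le_ord_clean {p n : ℕ} {κ : Type} [Field κ] {c : (Fin n → ℕ) → κ}
    (h : MultP p n κ c) : p ≤ ord n κ (clean p n κ c) := by
  obtain ⟨⟨A, hA⟩, hge⟩ := h
  unfold ord
  exact le_csInf ⟨_, A, hA, rfl⟩ (by rintro m ⟨B, hB, rfl⟩; exact hge B hB)

/-- Under `MultP c` the division exponent in `step` is `p`. [folklore] -/
theorem step_eq {p n : ℕ} {κ : Type} [Field κ] {c : (Fin n → ℕ) → κ} (i : Fin n) (τ : Fin n → κ)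
    (h : MultP p n κ c) :
    step p n κ i τ c = clean p n κ (tr n κ i τ p (dv n κ i p (bl n κ i (clean p n κ c)))) := by
  unfold step
  rw [if_pos (le_ord_clean h)]

/-- A coefficient all of whose exponents are divisible by `p` is deleted by cleaning. [folklore] -/
theorem clean_apply_of_dvd {p n : ℕ} {κ : Type} [Field κ] (c : (Fin n → ℕ) → κ) (A : Fin n → ℕ)
    (h : ∀ l, p ∣ A l) : clean p n κ c A = 0 := by
  unfold clean
  rw [if_pos h]

/-- A coefficient with some exponent prime to `p` survives cleaning. [folklore] -/
theorem clean_apply_of_not_dvd {p n : ℕ} {κ : Type} [Field κ] (c : (Fin n → ℕ) → κ)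
    (A : Fin n → ℕ) (l : Fin n) (h : ¬ p ∣ A l) : clean p n κ c A = c A := by
  unfold clean
  rw [if_neg (fun hall => h (hall l))]

/-! ## Two indices: `i` (the chart) and `j ≠ i` -/

/-- In `Fin 2`, every index is `i` or the other index `j`. [folklore] -/
theorem eq_or_eq : ∀ i j : Fin 2, j ≠ i → ∀ l : Fin 2, l = i ∨ l = j := by decide

/-- In `Fin 2`, erasing `i` leaves the other index. [folklore] -/
theorem univ_erase_eq {i j : Fin 2} (hj : j ≠ i) : Finset.univ.erase i = {j} := by
  ext l
  simp only [Finset.mem_erase, Finset.mem_univ, and_true, Finset.mem_singleton]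
  constructor
  · intro hl
    rcases eq_or_eq i j hj l with rfl | rfl
    · exact absurd rfl hl
    · rfl
  · rintro rfl
    exact hj

/-- A sum over `Fin 2` is the value at `i` plus the value at the other index. [folklore] -/
theorem sum_univ_eq {i j : Fin 2} (hj : j ≠ i) (B : Fin 2 → ℕ) :
    Finset.sum Finset.univ (fun l => B l) = B i + B j := by
  rw [← Finset.add_sum_erase Finset.univ (fun l => B l) (Finset.mem_univ i), univ_erase_eq hj,
    Finset.sum_singleton]

/-- Functions on `Fin 2` are determined by their values at `i` and at the other index. [folklore] -/
theorem funext₂ {i j : Fin 2} (hj : j ≠ i) {α : Type} {f g : Fin 2 → α} (hi : f i = g i)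
    (hj' : f j = g j) : f = g := by
  funext l
  rcases eq_or_eq i j hj l with rfl | rfl
  · exact hi
  · exact hj'

/-! ## The chart-`i` step in two variables -/

/-- Coefficients of `dv i s (bl i a)` in two variables: at `B` it is `a` at
`(i ↦ B i + s - B j, j ↦ B j)` if `B j ≤ B i + s`, else `0`. [folklore] -/
theorem dv_bl_apply {κ : Type} [Field κ] {i j : Fin 2} (hj : j ≠ i) (s : ℕ)
    (a : (Fin 2 → ℕ) → κ) (B : Fin 2 → ℕ) :
    dv 2 κ i s (bl 2 κ i a) B =
      if B j ≤ B i + s then a (Function.update B i (B i + s - B j)) else 0 := by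
  unfold dv bl
  rw [univ_erase_eq hj, Finset.sum_singleton, Function.update_self, Function.update_of_ne hj,
    Function.update_idem]
  split_ifs <;> rfl

/-- The translate of `dv i p (bl i a)` at the exponent `B = (i ↦ 0, j ↦ d)`, when `a` vanishes in
degree `p` beyond `j`-exponent `d`: only the untranslated term survives, giving `a (i ↦ p - d, j ↦ d)`.
[folklore] -/
theorem tr_dv_bl_apply {κ : Type} [Field κ] {i j : Fin 2} (hj : j ≠ i) (p d : ℕ) (hdp : d ≤ p)
    (a : (Fin 2 → ℕ) → κ) (τ : Fin 2 → κ) (B : Fin 2 → ℕ) (hBi : B i = 0) (hBj : B j = d)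
    (hmax : ∀ B' : Fin 2 → ℕ, B' i + B' j = p → d < B' j → a B' = 0) :
    tr 2 κ i τ p (dv 2 κ i p (bl 2 κ i a)) B = a (Function.update B i (p - d)) := by
  unfold tr
  rw [Finset.sum_eq_single (0 : Fin 2 → ℕ)]
  · rw [if_pos (show (0 : Fin 2 → ℕ) i = 0 from rfl), add_zero, dv_bl_apply hj,
      if_pos (show B j ≤ B i + p by omega), univ_erase_eq hj, Finset.prod_singleton]
    simp only [Pi.zero_apply, add_zero, Nat.choose_self, Nat.cast_one, pow_zero, mul_one, hBi, hBj,
      zero_add]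
  · intro D _ hD0
    by_cases hDi : D i = 0
    · rw [if_pos hDi, dv_bl_apply hj]
      by_cases hle : (B + D) j ≤ (B + D) i + p
      · rw [if_pos hle, hmax, zero_mul]
        · rw [Function.update_self, Function.update_of_ne hj]
          simp only [Pi.add_apply] at hle ⊢
          omega
        · have hDj : D j ≠ 0 := fun h => hD0 (funext₂ hj (by simp [hDi]) (by simp [h]))
          rw [Function.update_of_ne hj]
          simp only [Pi.add_apply]
          omega
      · rw [if_neg hle, zero_mul]
    · rw [if_neg hDi]
  · intro h
    exact absurd (by simp [Fintype.mem_piFinset]) h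

end OrdPExitSurface

/-- **Order exactly `p` exits multiplicity `p` (surfaces).** If the cleaned state `a` of
`z^p = a(u₁,u₂)` has multiplicity `p` (`MultP`) and a monomial of degree exactly `p` (`OrdP`), then
no successor `step p 2 κ i τ c` has multiplicity `p`: with `d` the largest `j`-exponent of a non-zero
degree-`p` monomial (`0 < d < p` since `a` is cleaned), the successor's coefficient at
`(i ↦ 0, j ↦ d)` is `a (i ↦ p - d, j ↦ d) ≠ 0`, of degree `d < p`. [folklore] -/
theorem stub_ordPExitSurface : ∀ p : ℕ, p.Prime → ∀ (κ : Type) [Field κ] [CharP κ p] [PerfectField κ] (c : (Fin 2 → ℕ) → κ) (i : Fin 2) (τ : Fin 2 → κ), MultP p 2 κ c → OrdP p 2 κ c → ¬ MultP p 2 κ (step p 2 κ i τ c) := by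
  intro p _ κ _ _ _ c i τ hM hO hM'
  -- the other index `j`
  obtain ⟨j, hj⟩ : ∃ j : Fin 2, j ≠ i := ⟨i.rev, (by decide : ∀ l : Fin 2, l.rev ≠ l) i⟩
  -- the degree-`p` exponent vectors `E k = (i ↦ p - k, j ↦ k)`
  obtain ⟨E, hEi, hEj⟩ : ∃ E : ℕ → Fin 2 → ℕ, (∀ k, E k i = p - k) ∧ ∀ k, E k j = k :=
    ⟨fun k l => if l = i then p - k else k, fun k => by simp, fun k => by simp [hj]⟩
  -- `OrdP` gives a non-zero degree-`p` coefficient, at `E (A j)`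
  obtain ⟨A, hA, hsum⟩ := hO
  have hAsum : A i + A j = p := (OrdPExitSurface.sum_univ_eq hj A).symm.trans hsum
  have hAE : A = E (A j) := OrdPExitSurface.funext₂ hj (by rw [hEi]; omega) (by rw [hEj])
  -- `d` := the largest `k ≤ p` with `a (E k) ≠ 0`
  obtain ⟨d, hPd, hdle, hmaxk⟩ : ∃ d, clean p 2 κ c (E d) ≠ 0 ∧ d ≤ p ∧
      ∀ k, d < k → k ≤ p → clean p 2 κ c (E k) = 0 :=
    ⟨Nat.findGreatest (fun k => clean p 2 κ c (E k) ≠ 0) p,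
      Nat.findGreatest_spec (P := fun k => clean p 2 κ c (E k) ≠ 0) (show A j ≤ p by omega)
        (by rw [← hAE]; exact hA),
      Nat.findGreatest_le p,
      fun k hk hkp => not_not.mp
        (Nat.findGreatest_is_greatest (P := fun k => clean p 2 κ c (E k) ≠ 0) hk hkp)⟩
  -- `d ≠ p` and `d ≠ 0`: the pure powers are deleted by cleaning
  have hdp : d ≠ p := by
    intro h
    apply hPd
    rw [h]
    refine OrdPExitSurface.clean_apply_of_dvd c (E p) (fun l => ?_)
    rcases OrdPExitSurface.eq_or_eq i j hj l with rfl | rfl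
    · rw [hEi]; simp
    · rw [hEj]
  have hd0 : d ≠ 0 := by
    intro h
    apply hPd
    rw [h]
    refine OrdPExitSurface.clean_apply_of_dvd c (E 0) (fun l => ?_)
    rcases OrdPExitSurface.eq_or_eq i j hj l with rfl | rfl
    · rw [hEi]; simp
    · rw [hEj]; simp
  have hdlt : d < p := lt_of_le_of_ne hdle hdp
  have hdpos : 0 < d := Nat.pos_of_ne_zero hd0
  -- maximality of `d`, phrased on arbitrary exponent vectors of degree `p`
  have hmax : ∀ B' : Fin 2 → ℕ, B' i + B' j = p → d < B' j → clean p 2 κ c B' = 0 := by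
    intro B' hB' hlt
    have hBE : B' = E (B' j) := OrdPExitSurface.funext₂ hj (by rw [hEi]; omega) (by rw [hEj])
    rw [hBE]
    exact hmaxk _ hlt (by omega)
  -- the witness exponent `Bs = (i ↦ 0, j ↦ d)` of the successor
  obtain ⟨Bs, hBsi, hBsj⟩ : ∃ B : Fin 2 → ℕ, B i = 0 ∧ B j = d :=
    ⟨fun l => if l = i then 0 else d, by simp, by simp [hj]⟩
  have hnd : ¬ p ∣ Bs j := by rw [hBsj]; exact Nat.not_dvd_of_pos_of_lt hdpos hdlt
  have hstep : clean p 2 κ (step p 2 κ i τ c) Bs = clean p 2 κ c (E d) := by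
    rw [OrdPExitSurface.clean_apply_of_not_dvd _ Bs j hnd, OrdPExitSurface.step_eq i τ hM,
      OrdPExitSurface.clean_apply_of_not_dvd _ Bs j hnd,
      OrdPExitSurface.tr_dv_bl_apply hj p d hdle _ τ Bs hBsi hBsj hmax]
    congr 1
    exact OrdPExitSurface.funext₂ hj (by rw [Function.update_self, hEi])
      (by rw [Function.update_of_ne hj, hBsj, hEj])
  have key := hM'.2 Bs (by rw [hstep]; exact hPd)
  rw [OrdPExitSurface.sum_univ_eq hj, hBsi, hBsj] at key
  omega

end Summit.ResolutionOfSingularities.ResolutionOfSingularities.Theorems.WildCones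

end
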